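import Summits.AtomisticToContinuum.Crystallization.Theorems.FrustratedLawDichotomyStrainedPatchHomEntryFitHcpRotReal
import Summits.AtomisticToContinuum.Crystallization.Theorems.FrustratedLawDichotomyStrainedPatchHomEntrySemantic

/-!
# `ParamTransfer` — the hcp fit hypotheses TRANSFER AT THE PARAMETER LEVEL: dilation strings and ξ-collars (lens-5 node 90, 27623 `(H) HomFloor (1/625)`)

decomp-a2c lens-5 gen 90 (crux `AperiodicFrustratedLawGap`, stmt-AtomisticToContinuum-27623; residual of record «(H) HomFloor» of
`…StrainedPatchHomSplit`, door of record node 88 `…HomEntrySemanticQuot.homFloor_of_entryTree6RBKP4_semOKHQ`; layout «FatCore» of node 89).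

THE OBSERVATION.  The landed real goodness theorem `…HomEntryFitHcpRotReal.goodAtScale_of_fitBounds_hcp_eta_minR` (the one every hcp fit
leaf kind calls) concludes `GoodAtScale (1/20) (3/2) z c` from (a) a LOCAL presentation of the strained hcp environment `(U, ξ)` around the centre
(radius `15/2`, not the full `133/10`-ball) and (b) eleven REAL INEQUALITIES about the twelve deformed neighbour vectors `nbrU U ξ k`
and the lattice points `latPt U hexFrame b` (fit against a rotated pattern at level `η' < 1/20`, distance enclosure `[dlo, dhi]`, clean
margin, far-shell margins), next to (c) the two WINDOW clauses `‖U − 1‖ ≤ 1/4`, `‖ξ‖ ≤ 1/2` about the actual parameter (supplied by the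
semantic layer / the leaf's own box, exactly as in `…CentredSqSound.fitOKHDCRS_sound`, whose proof derives (b) from integer checks and uses the
window only in its final call).  Package (b) as `HcpFitCore U ξ R η' dlo dhi d2lo` (§1).  Then (§2) the leaf conclusion of record
`…HomEntryLeafHT.HcpLeafGoal μ U ξ` follows for every `μ`, and — the point of the node — the CORE PACKAGE MOVES IN PARAMETER SPACE by pure algebra
(the window clauses never travel: they are asked of the actual parameter only):

* §3 DILATION (node 89 V-c «cone string»): `nbrU (s • U) ξ k = s • nbrU U ξ k`, `latPt (s • U) f b = s • latPt U f b`; for `s ≥ 1` every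
  inequality scales (the two absolute `1/100` margins only get easier), so `HcpFitCore U ξ R η' dlo dhi d2lo → HcpFitCore (s • U) ξ R η'
  (s·dlo) (s·dhi) (s²·d2lo)` under the single side condition `s·dhi ≤ 3/2` (★ `HcpFitCore.dilate`); hence ONE certificate at the most
  compressed box of a dilation string serves every box `B'` of the string whose points are dilations of certified points
  (★★ `hcpLeafGoal_of_cone`).  The shuffle `ξ` is a LATTICE coordinate: it does not move under dilation (no ξ-window drift).
* §4 ξ-COLLAR (node 89 V-b (iii), now WITHOUT configurations): `nbrU U ξ' k = nbrU U ξ k + [k ∈ B-sublattice]·U (ξ' − ξ)`, so with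
  `ρ ≥ ‖U (ξ' − ξ)‖` every norm moves by `≤ ρ`; a thin-box certificate in ROBUST form (`HcpFitCoreRobust`: fit residual `≤ e₀` in norm for all
  `2ρ`-NEAR-minimising scales, clean slack `23/10·ρ`, far slacks `13/10·ρ` / `23/10·ρ`) gives `HcpFitCore U ξ' R η' (dlo − ρ) (dhi + ρ) ((dlo − ρ)²)`
  whenever `e₀ + 2ρ ≤ η'·(dlo − ρ)` (★ `HcpFitCoreRobust.shift`; the `2ρ` is FAT-89's measured `2/d`-Lipschitz misfit law, now a theorem), hence
  the leaf goal on the whole ξ-collar of the thin box (★★ `hcpLeafGoal_of_collar`); and robust data DILATE too (★ `HcpFitCoreRobust.dilate`),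
  so collars and cones compose (V-b + V-c on one base certificate).

WHY IT IS HERE (memo `NODE-g90.md`).  Node 89 planned V-b through CONFIGURATIONS (B-atom shift of a presentation + the collar lemma
`…HomGoodCollar.goodAtScale_of_goodWith_shift`, with presentation surgery «the one real proof obligation of the port») and V-c through `goodAtScale_smul`
on clusters.  Both obligations DISAPPEAR at the parameter level: the presentation is never touched, the landed goodness theorem is applied unchanged
at the new parameter, and the only port left is kit-side bookkeeping (base-box certificate = `fitOKHDCRS_sound` STOPPED BEFORE ITS LAST CALL, i.e.
concluding `HcpFitCore`; robust slacks read off the same integer checks; two leaf kinds with integer membership tests).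

TAGS: §1–§2 [defs · formal repackaging of the tree theorem]; §3 [exact scaling · PROVED]; §4 [triangle inequalities · PROVED]; §5 [collar
test in box coordinates · PROVED]; the node's two non-Lean leaves are PORT items (kit base/robust read-outs `fitOKHDCRScore` / `fitOKHDCRSρ`;
manifest leaf kinds `coneLeaf` / `fatLeaf` with integer membership tests), both decidable bookkeeping.  Fully proved; standard axioms only;
nothing but `def`s and `theorem`s.  `--supports stmt-AtomisticToContinuum-27623`.
-/

noncomputable section

namespace Summit.AtomisticToContinuum.Crystallization.Theorems.FrustratedLawDichotomyStrainedPatchHomParamTransfer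

open scoped BigOperators RealInnerProductSpace
open Summit.AtomisticToContinuum.Crystallization.Theorems.ChargedEnergyGapNegative (E3)
open Summit.AtomisticToContinuum.Crystallization.Theorems.FrustratedLawDichotomyMotifLemmas (GoodAtScale)
open Summit.AtomisticToContinuum.Crystallization.Theorems.FrustratedLawDichotomyAveragingRuleTightFree (TightNearCap BadNearCap)
open Summit.AtomisticToContinuum.Crystallization.Theorems.FrustratedLawDichotomyExemptAbsorption (ExemptNear)
open Summit.AtomisticToContinuum.Crystallization.Theorems.FrustratedLawDichotomyAveragingCut (ball self_mem_ball)
open Summit.AtomisticToContinuum.Crystallization.Theorems.FrustratedLawDichotomyStrainedPatchHomSplit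
open Summit.AtomisticToContinuum.Crystallization.Theorems.FrustratedLawDichotomyStrainedPatchHomPrunes (locHom_hcp_centre)
open Summit.AtomisticToContinuum.Crystallization.Theorems.FrustratedLawDichotomyStrainedPatchHomEntryHcpFrame
open Summit.AtomisticToContinuum.Crystallization.Theorems.FrustratedLawDichotomyStrainedPatchHomEntryFitHcpCentred (goodAtScale_of_fitBounds_hcp_eta_minR)
open Summit.AtomisticToContinuum.Crystallization.Theorems.FrustratedLawDichotomyStrainedPatchHomEntryLeafHT (HcpLeafGoal)

/-! ## §1. The core package of real fit inequalities at a parameter pair `(U, ξ)` -/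

/-- **`HcpFitCore U ξ R η' dlo dhi d2lo`** — the eleven real CORE hypotheses of `goodAtScale_of_fitBounds_hcp_eta_minR` at the pair `(U, ξ)`
(everything except the two window clauses `‖U − 1‖ ≤ 1/4`, `‖ξ‖ ≤ 1/2`), with payload: the pattern rotation `R`, the fit level `η' < 1/20`, the
nearest-neighbour distance enclosure `[dlo, dhi]` and the squared scale floor `d2lo`.  This is what a box certificate establishes
(`…CentredSqSound.fitOKHDCRS_sound` derives exactly these from its integer checks) and what travels under dilation / ξ-shift. -/
def HcpFitCore (U : E3 →L[ℝ] E3) (ξ : E3) (R : E3 →ₗᵢ[ℝ] E3) (η' dlo dhi d2lo : ℝ) : Prop :=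
  0 ≤ η' ∧ η' < 1 / 20 ∧ 0 < dlo ∧ dhi ≤ 3 / 2 ∧
  (∀ k, dlo ≤ ‖nbrU U ξ k‖) ∧ (∃ k, ‖nbrU U ξ k‖ ≤ dhi) ∧ (∀ k, d2lo ≤ ‖nbrU U ξ k‖ ^ 2) ∧
  (∀ k k', (∀ j, ‖nbrU U ξ k'‖ ≤ ‖nbrU U ξ j‖) → ‖nbrU U ξ k - ‖nbrU U ξ k'‖ • R (nbr k)‖ ^ 2 ≤ η' ^ 2 * d2lo) ∧
  (∀ k, ‖nbrU U ξ k‖ ≤ 13 / 10 * dlo - 1 / 100) ∧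
  (∀ b ∈ (Fintype.piFinset fun _ : Fin 3 => Finset.Icc (-7 : ℤ) 7), b ≠ 0 → (∀ k, hshift k = false → hlab k ≠ b) →
    13 / 10 * dhi + 1 / 100 ≤ ‖latPt U hexFrame b‖) ∧
  (∀ b ∈ (Fintype.piFinset fun _ : Fin 3 => Finset.Icc (-7 : ℤ) 7), (∀ k, hshift k = true → hlab k ≠ b) →
    13 / 10 * dhi + 1 / 100 ≤ ‖latPt U hexFrame b + U (hcpShift + ξ)‖)

namespace HcpFitCore

variable {U : E3 →L[ℝ] E3} {ξ : E3} {R : E3 →ₗᵢ[ℝ] E3} {η' dlo dhi d2lo : ℝ} (h : HcpFitCore U ξ R η' dlo dhi d2lo)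
include h

/-- Accessor (`hη0`). [formal bookkeeping] -/ theorem hη0 : 0 ≤ η' := h.1
/-- Accessor (`hη`). [formal bookkeeping] -/ theorem hη : η' < 1 / 20 := h.2.1
/-- Accessor (`hdlo`). [formal bookkeeping] -/ theorem hdlo : 0 < dlo := h.2.2.1
/-- Accessor (`hdhi`). [formal bookkeeping] -/ theorem hdhi : dhi ≤ 3 / 2 := h.2.2.2.1
/-- Accessor (`hlo`). [formal bookkeeping] -/ theorem hlo : ∀ k, dlo ≤ ‖nbrU U ξ k‖ := h.2.2.2.2.1
/-- Accessor (`hhi`). [formal bookkeeping] -/ theorem hhi : ∃ k, ‖nbrU U ξ k‖ ≤ dhi := h.2.2.2.2.2.1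
/-- Accessor (`hd2`). [formal bookkeeping] -/ theorem hd2 : ∀ k, d2lo ≤ ‖nbrU U ξ k‖ ^ 2 := h.2.2.2.2.2.2.1
/-- Accessor (`hfit`). [formal bookkeeping] -/
theorem hfit : ∀ k k', (∀ j, ‖nbrU U ξ k'‖ ≤ ‖nbrU U ξ j‖) → ‖nbrU U ξ k - ‖nbrU U ξ k'‖ • R (nbr k)‖ ^ 2 ≤ η' ^ 2 * d2lo :=
  h.2.2.2.2.2.2.2.1
/-- Accessor (`hcl`). [formal bookkeeping] -/ theorem hcl : ∀ k, ‖nbrU U ξ k‖ ≤ 13 / 10 * dlo - 1 / 100 := h.2.2.2.2.2.2.2.2.1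
/-- Accessor (`hfarA`). [formal bookkeeping] -/
theorem hfarA : ∀ b ∈ (Fintype.piFinset fun _ : Fin 3 => Finset.Icc (-7 : ℤ) 7), b ≠ 0 → (∀ k, hshift k = false → hlab k ≠ b) →
    13 / 10 * dhi + 1 / 100 ≤ ‖latPt U hexFrame b‖ := h.2.2.2.2.2.2.2.2.2.1
/-- Accessor (`hfarB`). [formal bookkeeping] -/
theorem hfarB : ∀ b ∈ (Fintype.piFinset fun _ : Fin 3 => Finset.Icc (-7 : ℤ) 7), (∀ k, hshift k = true → hlab k ≠ b) →
    13 / 10 * dhi + 1 / 100 ≤ ‖latPt U hexFrame b + U (hcpShift + ξ)‖ := h.2.2.2.2.2.2.2.2.2.2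

end HcpFitCore

/-! ## §2. Soundness: window clauses + core package give centre goodness on every local presentation, hence the leaf goal at every level -/

section Sound
variable {U : E3 →L[ℝ] E3} {ξ : E3} {R : E3 →ₗᵢ[ℝ] E3} {η' dlo dhi d2lo : ℝ}

/-- ★ Window clauses + core package = the hypothesis list of the tree theorem: centre `1/20`-goodness on every `15/2`-local presentation. [repackaging] -/
theorem HcpFitCore.goodAtScale (hU : ‖U - 1‖ ≤ 1 / 4) (hξ : ‖ξ‖ ≤ 1 / 2) (h : HcpFitCore U ξ R η' dlo dhi d2lo) :
    ∀ (M : ℕ) (z : Fin M → E3) (c : Fin M), Function.Injective z →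
      (∀ x : E3, dist x (z c) < 15 / 2 → (x ∈ Set.range z ↔
        x - z c ∈ {v : E3 | ∃ b : Fin 3 → ℤ, v = latPt U hexFrame b ∨ v = latPt U hexFrame b + U (hcpShift + ξ)})) →
      GoodAtScale (1 / 20) (3 / 2) z c :=
  goodAtScale_of_fitBounds_hcp_eta_minR R U ξ hU hξ h.hη0 h.hη h.hdlo h.hdhi h.hlo h.hhi h.hd2 h.hfit h.hcl h.hfarA h.hfarB

/-- ★ … hence the hcp leaf goal of record at EVERY level `μ` (first disjunct, via `locHom_hcp_centre`; shape of `fitOKHDCRS_sound`). [bookkeeping] -/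
theorem HcpFitCore.hcpLeafGoal (hU : ‖U - 1‖ ≤ 1 / 4) (hξ : ‖ξ‖ ≤ 1 / 2) (h : HcpFitCore U ξ R η' dlo dhi d2lo) (μ : ℤ) : HcpLeafGoal μ U ξ :=
  Or.inl fun M z cc hz hrange => Or.inl ⟨cc, self_mem_ball (by norm_num) z cc, h.goodAtScale hU hξ M z cc hz (locHom_hcp_centre hrange)⟩

end Sound

/-! ## §3. DILATION: the package scales exactly (node 89 V-c «cone string») -/

section Dilation
variable {U : E3 →L[ℝ] E3} {ξ : E3} {R : E3 →ₗᵢ[ℝ] E3} {η' dlo dhi d2lo : ℝ}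

/-- `latPt` is linear in the deformation. [formal bookkeeping] -/
theorem latPt_smul (s : ℝ) (U : E3 →L[ℝ] E3) (f : Fin 3 → E3) (a : Fin 3 → ℤ) : latPt (s • U) f a = s • latPt U f a := rfl

/-- Pointwise scalar action of a dilated deformation (definitional). [formal bookkeeping] -/
theorem smul_clm_apply (s : ℝ) (U : E3 →L[ℝ] E3) (x : E3) : (s • U) x = s • U x := rfl

/-- The deformed neighbours are linear in the deformation (the shuffle `ξ` is a lattice coordinate and stays put). [formal bookkeeping] -/
theorem nbrU_smul (s : ℝ) (U : E3 →L[ℝ] E3) (ξ : E3) (k : Fin 12) : nbrU (s • U) ξ k = s • nbrU U ξ k := by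
  rw [nbrU_eq, nbrU_eq, smul_clm_apply]
  split_ifs
  · rw [smul_clm_apply, smul_add]
  · rw [add_zero, add_zero]

/-- Auxiliary step (`norm nbrU smul`). [formal bookkeeping] -/
theorem norm_nbrU_smul {s : ℝ} (hs : 0 ≤ s) (U : E3 →L[ℝ] E3) (ξ : E3) (k : Fin 12) : ‖nbrU (s • U) ξ k‖ = s * ‖nbrU U ξ k‖ := by
  rw [nbrU_smul, norm_smul, Real.norm_of_nonneg hs]

/-- ★ **DILATION of the core package**: for `s ≥ 1` every fit inequality at `(U, ξ)` scales to one at `(s • U, ξ)` with the distance payload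
scaled; the absolute margins `1/100` only slacken.  Single side condition: the scaled upper enclosure stays `≤ 3/2`. [folklore] -/
theorem HcpFitCore.dilate (h : HcpFitCore U ξ R η' dlo dhi d2lo) {s : ℝ} (hs : 1 ≤ s) (hdhi' : s * dhi ≤ 3 / 2) :
    HcpFitCore (s • U) ξ R η' (s * dlo) (s * dhi) (s ^ 2 * d2lo) := by
  have hs0 : (0 : ℝ) ≤ s := by linarith
  have hs1 : (0 : ℝ) < s := by linarith
  refine ⟨h.hη0, h.hη, mul_pos hs1 h.hdlo, hdhi', fun k => ?_, ?_, fun k => ?_, fun k k' hmin => ?_, fun k => ?_,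
    fun b hb hb0 hl => ?_, fun b hb hl => ?_⟩
  · rw [norm_nbrU_smul hs0]
    exact mul_le_mul_of_nonneg_left (h.hlo k) hs0
  · obtain ⟨k, hk⟩ := h.hhi
    exact ⟨k, by rw [norm_nbrU_smul hs0]; exact mul_le_mul_of_nonneg_left hk hs0⟩
  · rw [norm_nbrU_smul hs0, mul_pow]
    exact mul_le_mul_of_nonneg_left (h.hd2 k) (sq_nonneg s)
  · have hmin' : ∀ j, ‖nbrU U ξ k'‖ ≤ ‖nbrU U ξ j‖ := fun j =>
      le_of_mul_le_mul_left (by simpa only [norm_nbrU_smul hs0] using hmin j) hs1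
    have heq : nbrU (s • U) ξ k - ‖nbrU (s • U) ξ k'‖ • R (nbr k) = s • (nbrU U ξ k - ‖nbrU U ξ k'‖ • R (nbr k)) := by
      rw [nbrU_smul, norm_nbrU_smul hs0, smul_sub, smul_smul]
    rw [heq, norm_smul, Real.norm_of_nonneg hs0, mul_pow]
    calc s ^ 2 * ‖nbrU U ξ k - ‖nbrU U ξ k'‖ • R (nbr k)‖ ^ 2 ≤ s ^ 2 * (η' ^ 2 * d2lo) :=
          mul_le_mul_of_nonneg_left (h.hfit k k' hmin') (sq_nonneg s)
      _ = η' ^ 2 * (s ^ 2 * d2lo) := by ring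
  · rw [norm_nbrU_smul hs0]
    have := mul_le_mul_of_nonneg_left (h.hcl k) hs0
    nlinarith
  · rw [latPt_smul, norm_smul, Real.norm_of_nonneg hs0]
    have h1 := mul_le_mul_of_nonneg_left (h.hfarA b hb hb0 hl) hs0
    nlinarith [norm_nonneg (latPt U hexFrame b), h.hfarA b hb hb0 hl]
  · rw [latPt_smul, smul_clm_apply, ← smul_add, norm_smul, Real.norm_of_nonneg hs0]
    have h1 := mul_le_mul_of_nonneg_left (h.hfarB b hb hl) hs0
    nlinarith [norm_nonneg (latPt U hexFrame b + U (hcpShift + ξ)), h.hfarB b hb hl]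

/-- ★ The leaf goal on a dilated parameter (window clauses asked of the DILATED, i.e. actual, parameter). [formal bookkeeping] -/
theorem HcpFitCore.hcpLeafGoal_dilate (h : HcpFitCore U ξ R η' dlo dhi d2lo) {s : ℝ} (hs : 1 ≤ s) (hdhi' : s * dhi ≤ 3 / 2)
    (hU' : ‖s • U - 1‖ ≤ 1 / 4) (hξ : ‖ξ‖ ≤ 1 / 2) (μ : ℤ) : HcpLeafGoal μ (s • U) ξ :=
  (h.dilate hs hdhi').hcpLeafGoal hU' hξ μ

/-- ★★ **THE CONE STRING** (semantic soundness shape of a `coneLeaf`): if every point of a base set `B` of parameter pairs carries a core package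
with upper enclosure `≤ D`, then every pair `(U', ξ)` in the window that is a DILATION by some `s ∈ [1, 3/(2D)]` of a point of `B` meets the hcp
leaf goal at every level.  The membership `(s⁻¹ • U', ξ) ∈ B` is the leaf's integer interval test; NO window clause is asked on `B`. [folklore] -/
theorem hcpLeafGoal_of_cone {B : Set ((E3 →L[ℝ] E3) × E3)} {D : ℝ}
    (hcert : ∀ (U : E3 →L[ℝ] E3) (ξ : E3), (U, ξ) ∈ B →
      ∃ (R : E3 →ₗᵢ[ℝ] E3) (η' dlo dhi d2lo : ℝ), dhi ≤ D ∧ HcpFitCore U ξ R η' dlo dhi d2lo)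
    {U' : E3 →L[ℝ] E3} {ξ : E3} {s : ℝ} (hs : 1 ≤ s) (hmem : (s⁻¹ • U', ξ) ∈ B) (hD : s * D ≤ 3 / 2)
    (hU' : ‖U' - 1‖ ≤ 1 / 4) (hξ : ‖ξ‖ ≤ 1 / 2) (μ : ℤ) : HcpLeafGoal μ U' ξ := by
  obtain ⟨R, η', dlo, dhi, d2lo, hdD, h⟩ := hcert _ _ hmem
  have hs1 : (0 : ℝ) < s := by linarith
  have hUU : s • (s⁻¹ • U') = U' := by rw [smul_smul, mul_inv_cancel₀ hs1.ne', one_smul]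
  have hdhi' : s * dhi ≤ 3 / 2 := (mul_le_mul_of_nonneg_left hdD hs1.le).trans hD
  have := h.hcpLeafGoal_dilate hs hdhi' (by rw [hUU]; exact hU') hξ μ
  rwa [hUU] at this

end Dilation

/-! ## §4. ξ-COLLAR: the package is Lipschitz in the shuffle (node 89 V-b (iii), parameter level) -/

section Collar
variable {U : E3 →L[ℝ] E3} {ξ ξ' : E3} {R : E3 →ₗᵢ[ℝ] E3} {η' dlo dhi e₀ ρ : ℝ}

/-- The deformed neighbours move by the B-sublattice shift only. [formal bookkeeping] -/
theorem nbrU_shift (U : E3 →L[ℝ] E3) (ξ ξ' : E3) (k : Fin 12) :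
    nbrU U ξ' k = nbrU U ξ k + if hshift k then U (ξ' - ξ) else 0 := by
  rw [nbrU_eq, nbrU_eq]
  split_ifs
  · rw [map_sub]; abel
  · simp

/-- Every deformed neighbour moves by at most `ρ ≥ ‖U (ξ' − ξ)‖`. [folklore] -/
theorem norm_nbrU_shift_sub_le (hρ : ‖U (ξ' - ξ)‖ ≤ ρ) (k : Fin 12) : ‖nbrU U ξ' k - nbrU U ξ k‖ ≤ ρ := by
  have h0 : 0 ≤ ρ := (norm_nonneg _).trans hρ
  rw [nbrU_shift U ξ ξ' k, add_sub_cancel_left]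
  split_ifs
  · exact hρ
  · rwa [norm_zero]

/-- … hence every neighbour norm moves by at most `ρ`. [formal bookkeeping] -/
theorem abs_norm_nbrU_shift_le (hρ : ‖U (ξ' - ξ)‖ ≤ ρ) (k : Fin 12) : |‖nbrU U ξ' k‖ - ‖nbrU U ξ k‖| ≤ ρ :=
  (abs_norm_sub_norm_le _ _).trans (norm_nbrU_shift_sub_le hρ k)

/-- **`HcpFitCoreRobust U ξ R η' dlo dhi ρ e₀`** — the ROBUST thin-box core package at `(U, ξ)` for a ξ-collar of radius `ρ` (in `‖U ·‖`): the fit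
residual at the (exactly) minimising scales is bounded IN NORM by `e₀`, the clean inequality carries the slack `23/10·ρ`, the far-shell
inequalities the slacks `13/10·ρ` (A-sites, which do not move) and `23/10·ρ` (B-sites, which move by `≤ ρ`), and the budget
`e₀ + 2ρ ≤ η'·(dlo − ρ)` closes the transferred fit test (one `ρ` = the moved neighbour, one `ρ` = the minimal scale VALUE, which is `1`-Lipschitz).
(What the kit must read off the thin box: the achieved residual norm `e₀` and the slacks, as integer checks; no window clause.) -/
def HcpFitCoreRobust (U : E3 →L[ℝ] E3) (ξ : E3) (R : E3 →ₗᵢ[ℝ] E3) (η' dlo dhi ρ e₀ : ℝ) : Prop :=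
  0 ≤ η' ∧ η' < 1 / 20 ∧ 0 ≤ ρ ∧ ρ < dlo ∧ dhi + ρ ≤ 3 / 2 ∧
  (∀ k, dlo ≤ ‖nbrU U ξ k‖) ∧ (∃ k, ‖nbrU U ξ k‖ ≤ dhi) ∧
  (∀ k k', (∀ j, ‖nbrU U ξ k'‖ ≤ ‖nbrU U ξ j‖) → ‖nbrU U ξ k - ‖nbrU U ξ k'‖ • R (nbr k)‖ ≤ e₀) ∧
  e₀ + 2 * ρ ≤ η' * (dlo - ρ) ∧
  (∀ k, ‖nbrU U ξ k‖ ≤ 13 / 10 * dlo - 1 / 100 - 23 / 10 * ρ) ∧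
  (∀ b ∈ (Fintype.piFinset fun _ : Fin 3 => Finset.Icc (-7 : ℤ) 7), b ≠ 0 → (∀ k, hshift k = false → hlab k ≠ b) →
    13 / 10 * dhi + 1 / 100 + 13 / 10 * ρ ≤ ‖latPt U hexFrame b‖) ∧
  (∀ b ∈ (Fintype.piFinset fun _ : Fin 3 => Finset.Icc (-7 : ℤ) 7), (∀ k, hshift k = true → hlab k ≠ b) →
    13 / 10 * dhi + 1 / 100 + 23 / 10 * ρ ≤ ‖latPt U hexFrame b + U (hcpShift + ξ)‖)

namespace HcpFitCoreRobust

variable (h : HcpFitCoreRobust U ξ R η' dlo dhi ρ e₀)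
include h

/-- Accessor (`hη0`). [formal bookkeeping] -/ theorem hη0 : 0 ≤ η' := h.1
/-- Accessor (`hη`). [formal bookkeeping] -/ theorem hη : η' < 1 / 20 := h.2.1
/-- Accessor (`hρ0`). [formal bookkeeping] -/ theorem hρ0 : 0 ≤ ρ := h.2.2.1
/-- Accessor (`hρ`). [formal bookkeeping] -/ theorem hρ : ρ < dlo := h.2.2.2.1
/-- Accessor (`hdhi`). [formal bookkeeping] -/ theorem hdhi : dhi + ρ ≤ 3 / 2 := h.2.2.2.2.1
/-- Accessor (`hlo`). [formal bookkeeping] -/ theorem hlo : ∀ k, dlo ≤ ‖nbrU U ξ k‖ := h.2.2.2.2.2.1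
/-- Accessor (`hhi`). [formal bookkeeping] -/ theorem hhi : ∃ k, ‖nbrU U ξ k‖ ≤ dhi := h.2.2.2.2.2.2.1
/-- Accessor (`hfit`). [formal bookkeeping] -/
theorem hfit : ∀ k k', (∀ j, ‖nbrU U ξ k'‖ ≤ ‖nbrU U ξ j‖) → ‖nbrU U ξ k - ‖nbrU U ξ k'‖ • R (nbr k)‖ ≤ e₀ :=
  h.2.2.2.2.2.2.2.1
/-- Accessor (`he`). [formal bookkeeping] -/ theorem he : e₀ + 2 * ρ ≤ η' * (dlo - ρ) := h.2.2.2.2.2.2.2.2.1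
/-- Accessor (`hcl`). [formal bookkeeping] -/
theorem hcl : ∀ k, ‖nbrU U ξ k‖ ≤ 13 / 10 * dlo - 1 / 100 - 23 / 10 * ρ := h.2.2.2.2.2.2.2.2.2.1
/-- Accessor (`hfarA`). [formal bookkeeping] -/
theorem hfarA : ∀ b ∈ (Fintype.piFinset fun _ : Fin 3 => Finset.Icc (-7 : ℤ) 7), b ≠ 0 → (∀ k, hshift k = false → hlab k ≠ b) →
    13 / 10 * dhi + 1 / 100 + 13 / 10 * ρ ≤ ‖latPt U hexFrame b‖ := h.2.2.2.2.2.2.2.2.2.2.1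
/-- Accessor (`hfarB`). [formal bookkeeping] -/
theorem hfarB : ∀ b ∈ (Fintype.piFinset fun _ : Fin 3 => Finset.Icc (-7 : ℤ) 7), (∀ k, hshift k = true → hlab k ≠ b) →
    13 / 10 * dhi + 1 / 100 + 23 / 10 * ρ ≤ ‖latPt U hexFrame b + U (hcpShift + ξ)‖ := h.2.2.2.2.2.2.2.2.2.2.2

end HcpFitCoreRobust

/-- ★ **ξ-COLLAR TRANSFER**: the robust package at `(U, ξ)` gives the plain package at every `(U, ξ')` of the collar `‖U (ξ' − ξ)‖ ≤ ρ` (with `‖ξ'‖ ≤ 1/2`),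
payload `(dlo − ρ, dhi + ρ, (dlo − ρ)²)`.  Pure triangle inequalities; the `2ρ` in the budget is one `ρ` from the moved neighbour and one from the
minimal scale VALUE `min_j ‖nbrU j‖`, which moves by `≤ ρ` although the minimising INDEX may jump (`‖R (nbr k)‖ = 1`). [folklore] -/
theorem HcpFitCoreRobust.shift (h : HcpFitCoreRobust U ξ R η' dlo dhi ρ e₀) (hρ : ‖U (ξ' - ξ)‖ ≤ ρ) :
    HcpFitCore U ξ' R η' (dlo - ρ) (dhi + ρ) ((dlo - ρ) ^ 2) := by
  have hk : ∀ k, |‖nbrU U ξ' k‖ - ‖nbrU U ξ k‖| ≤ ρ := abs_norm_nbrU_shift_le hρ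
  have hup : ∀ k, ‖nbrU U ξ' k‖ ≤ ‖nbrU U ξ k‖ + ρ := fun k => by have := (abs_le.1 (hk k)).2; linarith
  have hdn : ∀ k, ‖nbrU U ξ k‖ - ρ ≤ ‖nbrU U ξ' k‖ := fun k => by have := (abs_le.1 (hk k)).1; linarith
  have hdρ : 0 < dlo - ρ := by linarith [h.hρ]
  refine ⟨h.hη0, h.hη, hdρ, h.hdhi, fun k => ?_, ?_, fun k => ?_, fun k k' hmin => ?_, fun k => ?_,
    fun b hb hb0 hl => ?_, fun b hb hl => ?_⟩
  · linarith [h.hlo k, hdn k]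
  · obtain ⟨k, hk'⟩ := h.hhi
    exact ⟨k, by linarith [hup k]⟩
  · have h1 : dlo - ρ ≤ ‖nbrU U ξ' k‖ := by linarith [h.hlo k, hdn k]
    exact pow_le_pow_left₀ hdρ.le h1 2
  · -- a minimiser `k₀` at `ξ`; the minimal scale VALUE moves by `≤ ρ`: `|‖nbrU ξ' k'‖ − ‖nbrU ξ k₀‖| ≤ ρ`
    obtain ⟨k₀, -, hk₀⟩ := Finset.exists_min_image Finset.univ (fun j : Fin 12 => ‖nbrU U ξ j‖) Finset.univ_nonempty
    have hmin₀ : ∀ j, ‖nbrU U ξ k₀‖ ≤ ‖nbrU U ξ j‖ := fun j => hk₀ j (Finset.mem_univ j)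
    have hf := h.hfit k k₀ hmin₀
    have hval : |‖nbrU U ξ' k'‖ - ‖nbrU U ξ k₀‖| ≤ ρ :=
      abs_le.2 ⟨by linarith [hmin₀ k', hdn k'], by linarith [hmin k₀, hup k₀]⟩
    -- the transferred residual in norm
    have hR : ‖R (nbr k)‖ = 1 := by rw [LinearIsometry.norm_map, norm_nbr]
    have hdec : nbrU U ξ' k - ‖nbrU U ξ' k'‖ • R (nbr k) =
        (nbrU U ξ k - ‖nbrU U ξ k₀‖ • R (nbr k)) + (nbrU U ξ' k - nbrU U ξ k) - (‖nbrU U ξ' k'‖ - ‖nbrU U ξ k₀‖) • R (nbr k) := by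
      rw [sub_smul]; abel
    have hn : ‖nbrU U ξ' k - ‖nbrU U ξ' k'‖ • R (nbr k)‖ ≤ e₀ + 2 * ρ := by
      rw [hdec]
      refine (norm_sub_le _ _).trans ?_
      have h1 := norm_add_le (nbrU U ξ k - ‖nbrU U ξ k₀‖ • R (nbr k)) (nbrU U ξ' k - nbrU U ξ k)
      have h2 : ‖(‖nbrU U ξ' k'‖ - ‖nbrU U ξ k₀‖) • R (nbr k)‖ ≤ ρ := by
        rw [norm_smul, hR, mul_one, Real.norm_eq_abs]; exact hval
      linarith [norm_nbrU_shift_sub_le hρ k]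
    have hn0 : 0 ≤ ‖nbrU U ξ' k - ‖nbrU U ξ' k'‖ • R (nbr k)‖ := norm_nonneg _
    have h3 : ‖nbrU U ξ' k - ‖nbrU U ξ' k'‖ • R (nbr k)‖ ≤ η' * (dlo - ρ) := hn.trans h.he
    calc ‖nbrU U ξ' k - ‖nbrU U ξ' k'‖ • R (nbr k)‖ ^ 2 ≤ (η' * (dlo - ρ)) ^ 2 := pow_le_pow_left₀ hn0 h3 2
      _ = η' ^ 2 * (dlo - ρ) ^ 2 := by ring
  · linarith [h.hcl k, hup k]
  · linarith [h.hfarA b hb hb0 hl]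
  · have heq : latPt U hexFrame b + U (hcpShift + ξ') = (latPt U hexFrame b + U (hcpShift + ξ)) + U (ξ' - ξ) := by
      rw [map_sub, map_add, map_add]; abel
    have h1 : ‖latPt U hexFrame b + U (hcpShift + ξ)‖ - ‖U (ξ' - ξ)‖ ≤ ‖latPt U hexFrame b + U (hcpShift + ξ')‖ := by
      rw [heq]
      have := norm_sub_le ((latPt U hexFrame b + U (hcpShift + ξ)) + U (ξ' - ξ)) (U (ξ' - ξ))
      rw [add_sub_cancel_right] at this
      linarith
    linarith [h.hfarB b hb hl]

/-- ★★ **THE ξ-COLLAR LEAF** (semantic soundness shape of a `fatLeaf`): a robust package on every point of a thin set `T` of shuffles (fixed `U`)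
gives the hcp leaf goal at every shuffle `ξ'` in the window of the `ρ`-collar of `T` in the metric `‖U ·‖`, at every level.  The collar
membership is the leaf's integer test (`‖U‖_op · dist`-type bound); the window clauses are asked of the actual `(U, ξ')` only. [folklore] -/
theorem hcpLeafGoal_of_collar {U : E3 →L[ℝ] E3} {T : Set E3} {ρ : ℝ}
    (hcert : ∀ ξ ∈ T, ∃ (R : E3 →ₗᵢ[ℝ] E3) (η' dlo dhi e₀ : ℝ), HcpFitCoreRobust U ξ R η' dlo dhi ρ e₀)
    {ξ' : E3} (hnear : ∃ ξ ∈ T, ‖U (ξ' - ξ)‖ ≤ ρ) (hU : ‖U - 1‖ ≤ 1 / 4) (hξ' : ‖ξ'‖ ≤ 1 / 2) (μ : ℤ) : HcpLeafGoal μ U ξ' := by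
  obtain ⟨ξ, hξT, hρ⟩ := hnear
  obtain ⟨R, η', dlo, dhi, e₀, h⟩ := hcert ξ hξT
  exact (h.shift hρ).hcpLeafGoal hU hξ' μ

/-- ★ **Robust packages DILATE** (`s ≥ 1`; collar radius and residual budget scale with `s`): cones of collars — V-b and V-c of node 89 compose on
ONE base certificate. [folklore] -/
theorem HcpFitCoreRobust.dilate (h : HcpFitCoreRobust U ξ R η' dlo dhi ρ e₀) {s : ℝ} (hs : 1 ≤ s) (hdhi' : s * (dhi + ρ) ≤ 3 / 2) :
    HcpFitCoreRobust (s • U) ξ R η' (s * dlo) (s * dhi) (s * ρ) (s * e₀) := by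
  have hs0 : (0 : ℝ) ≤ s := by linarith
  have hs1 : (0 : ℝ) < s := by linarith
  refine ⟨h.hη0, h.hη, mul_nonneg hs0 h.hρ0, mul_lt_mul_of_pos_left h.hρ hs1, by linarith, fun k => ?_, ?_,
    fun k k' hmin => ?_, ?_, fun k => ?_, fun b hb hb0 hl => ?_, fun b hb hl => ?_⟩
  · rw [norm_nbrU_smul hs0]
    exact mul_le_mul_of_nonneg_left (h.hlo k) hs0
  · obtain ⟨k, hk⟩ := h.hhi
    exact ⟨k, by rw [norm_nbrU_smul hs0]; exact mul_le_mul_of_nonneg_left hk hs0⟩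
  · have hmin' : ∀ j, ‖nbrU U ξ k'‖ ≤ ‖nbrU U ξ j‖ := fun j =>
      le_of_mul_le_mul_left (by simpa only [norm_nbrU_smul hs0] using hmin j) hs1
    have heq : nbrU (s • U) ξ k - ‖nbrU (s • U) ξ k'‖ • R (nbr k) = s • (nbrU U ξ k - ‖nbrU U ξ k'‖ • R (nbr k)) := by
      rw [nbrU_smul, norm_nbrU_smul hs0, smul_sub, smul_smul]
    rw [heq, norm_smul, Real.norm_of_nonneg hs0]
    exact mul_le_mul_of_nonneg_left (h.hfit k k' hmin') hs0
  · have := mul_le_mul_of_nonneg_left h.he hs0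
    nlinarith
  · rw [norm_nbrU_smul hs0]
    have := mul_le_mul_of_nonneg_left (h.hcl k) hs0
    nlinarith
  · rw [latPt_smul, norm_smul, Real.norm_of_nonneg hs0]
    have h1 := mul_le_mul_of_nonneg_left (h.hfarA b hb hb0 hl) hs0
    nlinarith [norm_nonneg (latPt U hexFrame b), h.hfarA b hb hb0 hl, h.hρ0]
  · rw [latPt_smul, smul_clm_apply, ← smul_add, norm_smul, Real.norm_of_nonneg hs0]
    have h1 := mul_le_mul_of_nonneg_left (h.hfarB b hb hl) hs0
    nlinarith [norm_nonneg (latPt U hexFrame b + U (hcpShift + ξ)), h.hfarB b hb hl, h.hρ0]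

/-- ★★ **CONE OF COLLARS**: a robust package at a base pair `(U, ξ)` serves every `(s • U, ξ')` in the window with `1 ≤ s ≤ 3/(2(dhi + ρ))` and
`‖(s • U)(ξ' − ξ)‖ ≤ s·ρ`. [folklore] -/
theorem hcpLeafGoal_of_cone_collar (h : HcpFitCoreRobust U ξ R η' dlo dhi ρ e₀) {s : ℝ} (hs : 1 ≤ s) (hdhi' : s * (dhi + ρ) ≤ 3 / 2)
    (hρ' : ‖(s • U) (ξ' - ξ)‖ ≤ s * ρ) (hU' : ‖s • U - 1‖ ≤ 1 / 4) (hξ' : ‖ξ'‖ ≤ 1 / 2) (μ : ℤ) : HcpLeafGoal μ (s • U) ξ' :=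
  ((h.dilate hs hdhi').shift hρ').hcpLeafGoal hU' hξ' μ

end Collar

/-! ## §5. Kit-facing membership tests: the collar radius from box coordinates -/

section Tests

/-- Squared Euclidean norm of a vector of `E3` in coordinates. [formal bookkeeping] -/
theorem norm_sq_eq_sum_coord_sq (δ : E3) : ‖δ‖ ^ 2 = ∑ i, (δ i) ^ 2 := by
  rw [EuclideanSpace.norm_eq, Real.sq_sqrt (Finset.sum_nonneg fun i _ => sq_nonneg _)]
  exact Finset.sum_congr rfl fun i _ => by rw [Real.norm_eq_abs, sq_abs]

/-- ★ **COLLAR TEST**: with `‖U − 1‖ ≤ κ` (the window `κ = 1/4`, or a certified Frobenius bound of the strain box), `‖U δ‖ ≤ (1 + κ) · m` as soon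
as `∑ᵢ δᵢ² ≤ m²` — so the collar hypothesis `‖U (ξ' − ξ)‖ ≤ ρ` of `hcpLeafGoal_of_collar` / `hcpLeafGoal_of_cone_collar` is discharged by ONE integer
inequality on the box coordinates of `ξ' − ξ` (`(1 + κ)² · ∑ᵢ (|c'ᵢ − cᵢ| + w'ᵢ + wᵢ)² ≤ (ρ·SC)²`). [folklore] -/
theorem norm_apply_le_of_coord_sq {U : E3 →L[ℝ] E3} {κ : ℝ} (hU : ‖U - 1‖ ≤ κ) {δ : E3} {m : ℝ} (hm : 0 ≤ m) (h : ∑ i, (δ i) ^ 2 ≤ m ^ 2) :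
    ‖U δ‖ ≤ (1 + κ) * m := by
  have hδ : ‖δ‖ ≤ m := (pow_le_pow_iff_left₀ (norm_nonneg δ) hm two_ne_zero).1 (by rw [norm_sq_eq_sum_coord_sq]; exact h)
  have hκ : 0 ≤ κ := (norm_nonneg _).trans hU
  have h1 : U δ = (U - 1) δ + δ := by simp
  have h2 : ‖(U - 1) δ‖ ≤ κ * ‖δ‖ := ((U - 1).le_opNorm δ).trans (mul_le_mul_of_nonneg_right hU (norm_nonneg δ))
  calc ‖U δ‖ = ‖(U - 1) δ + δ‖ := by rw [← h1]
    _ ≤ ‖(U - 1) δ‖ + ‖δ‖ := norm_add_le _ _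
    _ ≤ κ * m + m := by nlinarith
    _ = (1 + κ) * m := by ring

/-- ★ The collar leaf with the collar read in box coordinates: robust certificates on `T`, a strain bound `‖U − 1‖ ≤ κ` (`κ ≤ 1/4`) and a point
`ξ ∈ T` with `∑ᵢ (ξ'ᵢ − ξᵢ)² ≤ m²`, `(1 + κ)·m ≤ ρ`. [formal bookkeeping] -/
theorem hcpLeafGoal_of_collar_coord {U : E3 →L[ℝ] E3} {T : Set E3} {ρ κ m : ℝ}
    (hcert : ∀ ξ ∈ T, ∃ (R : E3 →ₗᵢ[ℝ] E3) (η' dlo dhi e₀ : ℝ), HcpFitCoreRobust U ξ R η' dlo dhi ρ e₀)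
    {ξ' : E3} (hκ : ‖U - 1‖ ≤ κ) (hκ4 : κ ≤ 1 / 4) (hm : 0 ≤ m) (hmρ : (1 + κ) * m ≤ ρ) (hnear : ∃ ξ ∈ T, ∑ i, ((ξ' - ξ) i) ^ 2 ≤ m ^ 2)
    (hξ' : ‖ξ'‖ ≤ 1 / 2) (μ : ℤ) : HcpLeafGoal μ U ξ' := by
  obtain ⟨ξ, hξT, hsq⟩ := hnear
  exact hcpLeafGoal_of_collar hcert ⟨ξ, hξT, (norm_apply_le_of_coord_sq hκ hm hsq).trans hmρ⟩ (hκ.trans hκ4) hξ' μ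

end Tests

end Summit.AtomisticToContinuum.Crystallization.Theorems.FrustratedLawDichotomyStrainedPatchHomParamTransfer
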